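import Mathlib
import HarnessLib

/-!
# Meshulam 1985, Theorem 1: matrices whose lexicographic leading entries are independent span a matrix
# of large rank — PROVED (the engine of Flanders' bound over an arbitrary field)

Topic `Literature/LinearAlgebra`; companion of `MeshulamBoundedRank.lean` (which states THEOREM 2 as the named
fact `Meshulam1985_exists_rank_gt` and is discharged from the present file).  Seat qa-qnc0-lit gen 10.

## The source (held `paper:doi-10-1093-qmath-36-2-225`, bib key `Meshulam1985`), followed step by step

R. Meshulam, *On the maximal rank in a subspace of matrices*, Quart. J. Math. Oxford (2) 36 (1985) 225–229.
p. 225: for `A ∈ M_n(F)`, `p(A)` = the position of the lexicographically first non-zero entry of `A`; a set of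
positions is *independent* if no two lie on a line (row or column).  **THEOREM 1** (p. 225): if among the leading
positions `p(A_1), …, p(A_m)` there is an independent set of size `r` (by Kőnig's theorem: iff they cannot be covered
by fewer than `r` lines), then `span{A_i}` contains a matrix of rank `≥ r`.  PROOF (pp. 225–226): take the `r × r`
minors `B_j` on the rows/columns of the independent leading positions, ordered by rows; the matrix `C` of the pivot
rows `b_j` is non-singular (triangular up to a column permutation); `D_j := B_j C⁻¹` has its first `j − 1` rows zero
and `j`-th row `e_j` ("(1)"); **Claim 1**: such `D_j` have a (`0`–`1`) combination which is non-singular (induction on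
`r`, expanding `det(Σ_{j<r} x_j D_j + D_r)` along the bottom row: it equals `det(Σ_{j<r} x_j D_j) + det(minor)`, "(2)");
hence `Σ x_j B_j = (Σ x_j D_j) C` is non-singular and `rank(Σ x_j A_j) ≥ r`.
For THEOREM 2 Meshulam covers `> rn` distinct positions by lines and invokes Kőnig; we replace Kőnig's theorem (not in
Mathlib) by the direct pigeonhole induction `exists_indep_of_card_gt` below (a row with `≥ r + 1` of the positions
exists, else `≤ rn` positions; remove that row, induct, and add a position of it in a fresh column) — the only
deviation from the printed proof.

## Contents (all proved)

* `exists_indep_of_card_gt` — `r·n < #P` for `P ⊆ [n] × [n]` ⟹ `r + 1` positions of `P` with pairwise distinct rows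
  and pairwise distinct columns.
* `claim1` — Meshulam's Claim 1.
* `rank_submatrix_le'` — the rank of a (not necessarily injective-indexed) submatrix is at most the rank.
* `exists_rank_ge_of_leading_indep` — THEOREM 1 in the form used for Theorem 2: `A_j` (`j < s`) with leading data
  `(k_j, l_j)` — `A_j (k_j) (l_j) ≠ 0`, rows above `k_j` zero, row `k_j` zero left of `l_j` — and `k`, `l` injective
  ⟹ some linear combination of the `A_j` has rank `≥ s`.

WHAT THIS IS NOT: Theorem 3 (the equality case) is not formalised; nothing here bears on any summit statement.
-/

namespace Literature.LinearAlgebra.Meshulam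

open Finset Matrix

variable {F : Type*} [Field F]

/-! ### Independent positions among more than `r·n` positions (replaces Kőnig's theorem in the proof of Thm 2) -/

/-- **Pigeonhole for independent positions.** If `P ⊆ [n] × [n]` has more than `r·n` elements, then it contains
`r + 1` positions with pairwise distinct rows and pairwise distinct columns.
[cite: Meshulam1985, proof of Thm. 2 (p. 226: "we cannot cover p(A_1),…,p(A_t) by less than t/n lines") with Kőnig's
theorem replaced by a direct induction] -/
theorem exists_indep_of_card_gt {n : ℕ} :
    ∀ (r : ℕ) (P : Finset (Fin n × Fin n)), r * n < #P →
      ∃ (k l : Fin (r + 1) → Fin n), Function.Injective k ∧ Function.Injective l ∧ ∀ j, (k j, l j) ∈ P := by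
  intro r
  induction r with
  | zero =>
    intro P hP
    obtain ⟨q, hq⟩ : P.Nonempty := card_pos.1 (by omega)
    have hsub : ∀ a b : Fin (0 + 1), a = b := fun a b => by
      have ha := a.isLt; have hb := b.isLt; apply Fin.ext; omega
    exact ⟨fun _ => q.1, fun _ => q.2, fun a b _ => hsub a b, fun a b _ => hsub a b, fun _ => hq⟩
  | succ r ih =>
    intro P hP
    classical
    -- a row carrying at least `r + 2` positions of `P`
    have hrow : ∃ i : Fin n, r + 2 ≤ #(P.filter fun q => q.1 = i) := by
      by_contra h
      push Not at h
      have hsum : #P = ∑ i : Fin n, #(P.filter fun q => q.1 = i) :=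
        card_eq_sum_card_fiberwise (f := Prod.fst) (t := univ) fun q _ => mem_coe.2 (mem_univ _)
      have : #P ≤ ∑ _i : Fin n, (r + 1) := hsum.le.trans (sum_le_sum fun i _ => Nat.lt_succ_iff.1 (h i))
      rw [sum_const, card_univ, Fintype.card_fin, smul_eq_mul] at this
      exact absurd hP (not_lt.2 (by simpa [Nat.succ_mul, mul_comm] using this))
    obtain ⟨i, hi⟩ := hrow
    set R := P.filter fun q => q.1 = i with hR
    set P' := P.filter fun q => q.1 ≠ i with hP'
    -- `#R ≤ n` (second coordinates are distinct on a row)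
    have hRinj : Set.InjOn Prod.snd (R : Set (Fin n × Fin n)) := by
      intro a ha b hb hab
      have ha1 : a.1 = i := (mem_filter.1 (mem_coe.1 ha)).2
      have hb1 : b.1 = i := (mem_filter.1 (mem_coe.1 hb)).2
      exact Prod.ext (ha1.trans hb1.symm) hab
    have hRcard : #R = #(R.image Prod.snd) := (card_image_of_injOn hRinj).symm
    have hRle : #R ≤ n := by
      rw [hRcard]; exact (card_le_univ _).trans_eq (Fintype.card_fin n)
    -- the rest of `P`
    have hsplit : #R + #P' = #P := by
      rw [hR, hP']
      exact card_filter_add_card_filter_not (s := P) (fun q : Fin n × Fin n => q.1 = i)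
    have hP'card : r * n < #P' := by
      have h1 : (r + 1) * n + 1 ≤ #P := hP
      have : r * n + n = (r + 1) * n := by ring
      omega
    obtain ⟨k', l', hk', hl', hmem'⟩ := ih P' hP'card
    -- a position of row `i` in a column not used by `l'`
    have hcol : ∃ c ∈ R.image Prod.snd, c ∉ univ.image l' := by
      by_contra h
      push Not at h
      have hsub : R.image Prod.snd ⊆ univ.image l' := fun c hc => h c hc
      have := card_le_card hsub
      rw [← hRcard] at this
      have h2 : #(univ.image l') ≤ r + 1 := card_image_le.trans_eq (by rw [card_univ, Fintype.card_fin])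
      omega
    obtain ⟨c, hc, hcl⟩ := hcol
    obtain ⟨q, hqR, hqc⟩ := mem_image.1 hc
    have hqP : (i, c) ∈ P := by
      have hq := mem_filter.1 hqR
      have : q = (i, c) := Prod.ext hq.2 hqc
      rw [← this]; exact hq.1
    refine ⟨Fin.cons i k', Fin.cons c l', ?_, ?_, ?_⟩
    · refine Fin.cons_injective_iff.2 ⟨?_, hk'⟩
      rintro ⟨j, hj⟩
      have := (mem_filter.1 (hmem' j)).2
      exact this hj
    · refine Fin.cons_injective_iff.2 ⟨?_, hl'⟩
      rintro ⟨j, hj⟩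
      exact hcl (mem_image.2 ⟨j, mem_univ _, hj⟩)
    · intro j
      refine Fin.cases ?_ (fun j => ?_) j
      · simpa using hqP
      · simpa using (mem_filter.1 (hmem' j)).1

/-! ### Claim 1 -/

/-- `det (Y + E) = det Y + det (minor)` when `E` is zero except for a `1` in the bottom-right corner
(expansion along the bottom row — equation (2) of the source). [cite: Meshulam1985, proof of Claim 1, eq. (2) (p. 226)] -/
theorem det_add_corner {r : ℕ} (Y E : Matrix (Fin (r + 1)) (Fin (r + 1)) F)
    (hE : ∀ i, i ≠ Fin.last r → E i = 0) (hElast : E (Fin.last r) = Pi.single (Fin.last r) 1) :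
    (Y + E).det = Y.det + (Y.submatrix Fin.castSucc Fin.castSucc).det := by
  classical
  have hYE : Y + E = Y.updateRow (Fin.last r) (Y (Fin.last r) + Pi.single (Fin.last r) 1) := by
    ext i j
    by_cases hi : i = Fin.last r
    · subst hi
      rw [updateRow_self, Matrix.add_apply, hElast]
      rfl
    · rw [updateRow_ne hi, Matrix.add_apply, hE i hi]
      simp
  rw [hYE, det_updateRow_add, updateRow_eq_self]
  congr 1
  rw [det_succ_row _ (Fin.last r), Fintype.sum_eq_single (Fin.last r)]
  · rw [updateRow_self, Pi.single_eq_same, mul_one, Fin.succAbove_last]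
    have heven : Even ((Fin.last r : ℕ) + (Fin.last r : ℕ)) := ⟨_, rfl⟩
    rw [heven.neg_one_pow, one_mul]
    congr 1
    ext a b
    simp only [submatrix_apply]
    rw [updateRow_ne (Fin.castSucc_lt_last a).ne]
  · intro j hj
    rw [updateRow_self, Pi.single_eq_of_ne hj, mul_zero, zero_mul]

/-- **Claim 1** of the source: if `D_1, …, D_r ∈ M_r(F)` are such that the rows of `D_j` above row `j` vanish and
row `j` of `D_j` is the `j`-th unit vector, then some linear combination of the `D_j` is non-singular (the source
produces `0`–`1` coefficients; any coefficients suffice for Theorem 2). [cite: Meshulam1985, Claim 1 (p. 226)] -/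
theorem claim1 : ∀ (r : ℕ) (D : Fin r → Matrix (Fin r) (Fin r) F),
    (∀ j i, i < j → D j i = 0) → (∀ j, D j j = Pi.single j 1) →
      ∃ x : Fin r → F, (∑ j, x j • D j).det ≠ 0 := by
  intro r
  induction r with
  | zero =>
    intro D _ _
    exact ⟨Fin.elim0, by rw [det_isEmpty]; exact one_ne_zero⟩
  | succ r ih =>
    intro D hlow hdiag
    classical
    -- the restrictions of `D_1, …, D_{r}` to the top-left `r × r` block satisfy the hypotheses for `r`
    set D' : Fin r → Matrix (Fin r) (Fin r) F :=
      fun j => (D (Fin.castSucc j)).submatrix Fin.castSucc Fin.castSucc with hD'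
    have hlow' : ∀ j i, i < j → D' j i = 0 := by
      intro j i hij
      funext c
      have := hlow (Fin.castSucc j) (Fin.castSucc i) (Fin.castSucc_lt_castSucc_iff.2 hij)
      simp only [hD', submatrix_apply]
      rw [this]; rfl
    have hdiag' : ∀ j, D' j j = Pi.single j 1 := by
      intro j
      funext c
      simp only [hD', submatrix_apply]
      rw [hdiag (Fin.castSucc j)]
      by_cases h : c = j
      · subst h; simp
      · rw [Pi.single_eq_of_ne h, Pi.single_eq_of_ne (fun h' => h (Fin.castSucc_injective _ h'))]
    obtain ⟨x', hx'⟩ := ih D' hlow' hdiag'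
    set Y : Matrix (Fin (r + 1)) (Fin (r + 1)) F := ∑ j : Fin r, x' j • D (Fin.castSucc j) with hY
    have hYsub : Y.submatrix Fin.castSucc Fin.castSucc = ∑ j : Fin r, x' j • D' j := by
      ext a b
      rw [hY]
      simp only [hD', submatrix_apply, Matrix.sum_apply, Matrix.smul_apply]
    -- the last matrix is the corner unit
    have hE : ∀ i, i ≠ Fin.last r → D (Fin.last r) i = 0 :=
      fun i hi => hlow _ _ (lt_of_le_of_ne (Fin.le_last i) hi)
    have hElast : D (Fin.last r) (Fin.last r) = Pi.single (Fin.last r) 1 := hdiag _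
    have hsum : ∀ t : F, ∑ j : Fin (r + 1), (Fin.snoc x' t : Fin (r + 1) → F) j • D j = Y + t • D (Fin.last r) := by
      intro t
      rw [Fin.sum_univ_castSucc]
      simp only [Fin.snoc_castSucc, Fin.snoc_last, hY]
    by_cases hdet : Y.det ≠ 0
    · refine ⟨Fin.snoc x' 0, ?_⟩
      rw [hsum, zero_smul, add_zero]
      exact hdet
    · refine ⟨Fin.snoc x' 1, ?_⟩
      rw [hsum, one_smul, det_add_corner Y _ hE hElast, not_ne_iff.1 hdet, zero_add, hYsub]
      exact hx'

/-! ### Theorem 1 -/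

/-- The rank of a submatrix (rows and columns selected by arbitrary maps) is at most the rank. [folklore] -/
private theorem rank_submatrix_le' {n s : ℕ} (M : Matrix (Fin n) (Fin n) F) (k l : Fin s → Fin n) :
    (M.submatrix k l).rank ≤ M.rank := by
  classical
  have h1 : (1 : Matrix (Fin n) (Fin n) F).submatrix k id * M = M.submatrix k id := by
    have := submatrix_mul (1 : Matrix (Fin n) (Fin n) F) M k id id Function.bijective_id
    rw [Matrix.one_mul, submatrix_id_id] at this
    exact this.symm
  have h2 : M.submatrix k id * (1 : Matrix (Fin n) (Fin n) F).submatrix id l = M.submatrix k l := by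
    have := submatrix_mul M (1 : Matrix (Fin n) (Fin n) F) k id l Function.bijective_id
    rw [Matrix.mul_one] at this
    exact this.symm
  calc (M.submatrix k l).rank
      = ((1 : Matrix (Fin n) (Fin n) F).submatrix k id * M * (1 : Matrix (Fin n) (Fin n) F).submatrix id l).rank := by
        rw [h1, h2]
    _ ≤ ((1 : Matrix (Fin n) (Fin n) F).submatrix k id * M).rank := rank_mul_le_left _ _
    _ ≤ M.rank := rank_mul_le_right _ _

/-- **Meshulam 1985, Theorem 1** (in the form used for Theorem 2).  Let `A_j ∈ M_n(F)` (`j < s`) have "leading data"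
`(k_j, l_j)`: `A_j (k_j, l_j) ≠ 0`, every row of `A_j` above `k_j` vanishes and row `k_j` vanishes left of `l_j` (this
holds when `(k_j, l_j) = p(A_j)` is the lexicographically first non-zero entry), with the positions independent
(`k` and `l` injective).  Then some linear combination of the `A_j` has rank `≥ s`. [cite: Meshulam1985, Thm. 1 (p. 225)] -/
theorem exists_rank_ge_of_leading_indep {n s : ℕ} (A : Fin s → Matrix (Fin n) (Fin n) F) (k l : Fin s → Fin n)
    (hk : Function.Injective k) (hl : Function.Injective l) (hne : ∀ j, A j (k j) (l j) ≠ 0)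
    (hrow : ∀ j i, i < k j → A j i = 0) (hcol : ∀ j c, c < l j → A j (k j) c = 0) :
    ∃ x : Fin s → F, s ≤ (∑ j, x j • A j).rank := by
  classical
  -- WLOG the rows `k_j` are increasing in `j` (reindex by the sorting permutation)
  suffices H : ∀ (A : Fin s → Matrix (Fin n) (Fin n) F) (k l : Fin s → Fin n), StrictMono k →
      Function.Injective l → (∀ j, A j (k j) (l j) ≠ 0) → (∀ j i, i < k j → A j i = 0) →
      (∀ j c, c < l j → A j (k j) c = 0) → ∃ x : Fin s → F, s ≤ (∑ j, x j • A j).rank by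
    set σ := Tuple.sort k with hσ
    have hmono : StrictMono (k ∘ σ) := (Tuple.monotone_sort k).strictMono_of_injective (hk.comp σ.injective)
    obtain ⟨x, hx⟩ := H (A ∘ σ) (k ∘ σ) (l ∘ σ) hmono (hl.comp σ.injective) (fun j => hne (σ j))
      (fun j i hi => hrow (σ j) i hi) (fun j c hc => hcol (σ j) c hc)
    refine ⟨x ∘ σ.symm, ?_⟩
    have : ∑ j, (x ∘ σ.symm) j • A j = ∑ j, x j • (A ∘ σ) j := by
      rw [← Equiv.sum_comp σ]
      simp
    rw [this]; exact hx
  intro A k l hk hl hne hrow hcol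
  -- the minors `B_j` and the pivot-row matrix `C`
  set B : Fin s → Matrix (Fin s) (Fin s) F := fun j => (A j).submatrix k l with hB
  set C : Matrix (Fin s) (Fin s) F := fun j c => A j (k j) (l c) with hC
  -- `C` is non-singular: its rows are linearly independent (look at the column of the minimal `l`)
  have hCunit : IsUnit C := by
    rw [← linearIndependent_rows_iff_isUnit, Fintype.linearIndependent_iff]
    intro g hg
    by_contra hne0
    push Not at hne0
    obtain ⟨j₀, hj₀⟩ := hne0
    obtain ⟨j₁, hj₁, hmin⟩ := exists_min_image (univ.filter fun j => g j ≠ 0) l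
      ⟨j₀, mem_filter.2 ⟨mem_univ _, hj₀⟩⟩
    have hg₁ : g j₁ ≠ 0 := (mem_filter.1 hj₁).2
    have hsum : ∑ j, g j * C j j₁ = 0 := by
      have := congr_fun hg j₁
      simpa only [Finset.sum_apply, Pi.smul_apply, smul_eq_mul, Pi.zero_apply, row_apply'] using this
    rw [sum_eq_single j₁] at hsum
    · exact hg₁ ((mul_eq_zero.1 hsum).resolve_right (hne j₁))
    · intro j _ hj
      by_cases hgj : g j = 0
      · rw [hgj, zero_mul]
      · have hlt : l j₁ < l j :=
          lt_of_le_of_ne (hmin j (mem_filter.2 ⟨mem_univ _, hgj⟩)) (fun h => hj (hl h).symm)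
        show g j * A j (k j) (l j₁) = 0
        rw [hcol j _ hlt, mul_zero]
    · intro h; exact absurd (mem_univ _) h
  have hCdet : IsUnit C.det := (isUnit_iff_isUnit_det C).1 hCunit
  -- `D_j := B_j C⁻¹` satisfies (1)
  set D : Fin s → Matrix (Fin s) (Fin s) F := fun j => B j * C⁻¹ with hD
  have hDlow : ∀ j i, i < j → D j i = 0 := by
    intro j i hij
    funext c
    simp only [hD, mul_apply]
    refine sum_eq_zero fun t _ => ?_
    have : B j i t = 0 := by
      simp only [hB, submatrix_apply]
      rw [hrow j (k i) (hk hij)]; rfl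
    rw [this, zero_mul]
  have hDdiag : ∀ j, D j j = Pi.single j 1 := by
    intro j
    have hBj : B j j = C j := rfl
    funext c
    have : D j j c = (C * C⁻¹) j c := by
      simp only [hD, mul_apply, hBj]
    rw [this, mul_nonsing_inv C hCdet, one_apply, Pi.single_apply]
    by_cases h : j = c
    · rw [if_pos h, if_pos h.symm]
    · rw [if_neg h, if_neg (Ne.symm h)]
  obtain ⟨x, hx⟩ := claim1 s D hDlow hDdiag
  -- `Σ x_j B_j = (Σ x_j D_j) C` is non-singular
  have hBsum : ∑ j, x j • B j = (∑ j, x j • D j) * C := by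
    rw [sum_mul]
    refine sum_congr rfl fun j _ => ?_
    rw [smul_mul_assoc]
    show x j • B j = x j • (B j * C⁻¹ * C)
    rw [nonsing_inv_mul_cancel_right C (B j) hCdet]
  have hBunit : IsUnit (∑ j, x j • B j) := by
    rw [isUnit_iff_isUnit_det, hBsum, det_mul]
    exact (isUnit_iff_ne_zero.2 hx).mul hCdet
  -- it is the `(k,l)`-minor of `Σ x_j A_j`
  have hsub : (∑ j, x j • A j).submatrix k l = ∑ j, x j • B j := by
    ext a b
    simp only [hB, submatrix_apply, Matrix.sum_apply, Matrix.smul_apply]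
  refine ⟨x, ?_⟩
  calc s = Fintype.card (Fin s) := (Fintype.card_fin s).symm
    _ = ((∑ j, x j • A j).submatrix k l).rank := by rw [hsub, rank_of_isUnit _ hBunit]
    _ ≤ (∑ j, x j • A j).rank := rank_submatrix_le' _ k l

end Literature.LinearAlgebra.Meshulam
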